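import Mathlib.Analysis.SpecialFunctions.Pow.Real
import Mathlib.Data.Nat.Choose.Bounds
import Mathlib.Data.Nat.Choose.Central
import Mathlib.Data.Nat.Choose.Sum
import Literature.Probability.LatticeModels.UniformStepWalk
import HarnessLib

/-!
# `GradedDesignFamily`, line `schur-weyl-colour-cells`: stub `stub_ballotMaxBound`
# (the largest two-row degree, with a power saving)

Crux `stmt-MatrixMultiplication-7610`
(`Summit.MatrixMultiplication.MatrixMultiplication.Theses.LevelGradedCohnUmans.GradedDesignFamily`),
line `schur-weyl-colour-cells`, registered stub B2 `stub_ballotMaxBound`: there are real constants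
`C` and `δ > 0` with
`C(n,j) (n - 2j + 1) / (n - j + 1) ≤ C · 2ⁿ · n ^ (-(3/4 + δ))` for all `n ≥ 1` and `2j ≤ n`
(the left-hand side is the ballot number `f^(n-j,j)`, the degree of the two-row irreducible of `𝔖ₙ`).
We prove it with `C = 6`, `δ = 1/8` (the truth is `δ = 1/4`: the ballot numbers peak at `≍ 2ⁿ/n`
for `n - 2j ≍ √n`).

## Proof (purely algebraic)

* Binomial moments, by induction on `n` via Pascal's rule (`Finset.sum_choose_succ_mul`) with
  `(x+1)² + (x-1)² = 2x² + 2` and `(x+1)⁴ + (x-1)⁴ = 2x⁴ + 12x² + 2`: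
  `Σ_j C(n,j) (n - 2j)² = n 2ⁿ` and `Σ_j C(n,j) (n - 2j)⁴ = n (3n - 2) 2ⁿ` (`binomMoments`), whence
  `(n - 2j)⁴ C(n,j) ≤ 3 n² 2ⁿ` for each `j ≤ n` (`fourthMoment_term_le`).
* Central bound: `C(n,j)² (n+1) ≤ C(n,⌊n/2⌋)² (n+1) ≤ 4ⁿ` (`Nat.choose_le_middle` and the tree's
  `Literature.Probability.LatticeModels.UniformStep.choose_half_sq_mul_succ_le`)
  (`choose_sq_mul_succ_le`).
* Hence `((n - 2j) C(n,j))⁸ = ((n - 2j)⁴ C)² (C²)³ ≤ 9 n⁴ 4ⁿ (4ⁿ/n)³ = 9 n 2^{8n} ≤ (2 · 2ⁿ · n^{1/8})⁸`,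
  so `(n - 2j) C(n,j) ≤ 2 · 2ⁿ n^{1/8}`, and `C(n,j) ≤ 2ⁿ ≤ 2ⁿ n^{1/8}` (`Nat.choose_le_two_pow`);
  with `n - j + 1 ≥ n/2` this gives `C(n,j)(n - 2j + 1)/(n - j + 1) ≤ 3 · 2ⁿ n^{1/8} · (2/n)
  = 6 · 2ⁿ · n^{-7/8}`.
-/

set_option linter.dupNamespace false

noncomputable section

open scoped BigOperators
open Finset

namespace Summit.MatrixMultiplication.MatrixMultiplication.Theorems.GradedDesignFamily

/-- Pascal step for a binomial sum of a function of the index: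
`Σ_{i ≤ n+1} C(n+1,i) g(i) = Σ_{i ≤ n} C(n,i) (g(i) + g(i+1))`. -/
theorem sum_choose_succ_mul_apply (g : ℕ → ℝ) (n : ℕ) :
    ∑ i ∈ range (n + 1 + 1), ((n + 1).choose i : ℝ) * g i =
      ∑ i ∈ range (n + 1), (n.choose i : ℝ) * (g i + g (i + 1)) := by
  have h := Finset.sum_choose_succ_mul (fun i _ => g i) n
  rw [show n + 1 + 1 = n + 2 from rfl, h, ← sum_add_distrib]
  exact sum_congr rfl fun i _ => by ring

/-- The second and fourth central moments of the binomial distribution: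
`Σ_{j ≤ n} C(n,j) (n - 2j)² = n · 2ⁿ` and `Σ_{j ≤ n} C(n,j) (n - 2j)⁴ = n (3n - 2) · 2ⁿ`. -/
theorem binomMoments (n : ℕ) :
    (∑ j ∈ range (n + 1), (n.choose j : ℝ) * ((n : ℝ) - 2 * j) ^ 2 = (n : ℝ) * 2 ^ n) ∧
      ∑ j ∈ range (n + 1), (n.choose j : ℝ) * ((n : ℝ) - 2 * j) ^ 4 =
        (n : ℝ) * (3 * (n : ℝ) - 2) * 2 ^ n := by
  induction n with
  | zero => simp
  | succ n ih =>
    obtain ⟨ih2, ih4⟩ := ih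
    have h0 : ∑ j ∈ range (n + 1), (n.choose j : ℝ) = 2 ^ n := by
      exact_mod_cast Nat.sum_range_choose n
    have e2 : ∀ j : ℕ, (n.choose j : ℝ) * ((((n + 1 : ℕ) : ℝ) - 2 * j) ^ 2 +
        (((n + 1 : ℕ) : ℝ) - 2 * ((j + 1 : ℕ) : ℝ)) ^ 2) =
        2 * ((n.choose j : ℝ) * ((n : ℝ) - 2 * j) ^ 2) + 2 * (n.choose j : ℝ) := by
      intro j; push_cast; ring
    have e4 : ∀ j : ℕ, (n.choose j : ℝ) * ((((n + 1 : ℕ) : ℝ) - 2 * j) ^ 4 +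
        (((n + 1 : ℕ) : ℝ) - 2 * ((j + 1 : ℕ) : ℝ)) ^ 4) =
        2 * ((n.choose j : ℝ) * ((n : ℝ) - 2 * j) ^ 4) +
          12 * ((n.choose j : ℝ) * ((n : ℝ) - 2 * j) ^ 2) + 2 * (n.choose j : ℝ) := by
      intro j; push_cast; ring
    refine ⟨?_, ?_⟩
    · rw [sum_choose_succ_mul_apply (fun j => (((n + 1 : ℕ) : ℝ) - 2 * j) ^ 2) n,
        sum_congr rfl fun j _ => e2 j, sum_add_distrib, ← mul_sum, ← mul_sum, ih2, h0]
      push_cast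
      ring
    · rw [sum_choose_succ_mul_apply (fun j => (((n + 1 : ℕ) : ℝ) - 2 * j) ^ 4) n,
        sum_congr rfl fun j _ => e4 j, sum_add_distrib, sum_add_distrib, ← mul_sum, ← mul_sum,
        ← mul_sum, ih4, ih2, h0]
      push_cast
      ring

/-- Each term of the fourth moment is at most `3 n² 2ⁿ`: `(n - 2j)⁴ C(n,j) ≤ 3 n² 2ⁿ`
for `j ≤ n`. -/
theorem fourthMoment_term_le (n j : ℕ) (hj : j ≤ n) :
    ((n : ℝ) - 2 * j) ^ 4 * (n.choose j : ℝ) ≤ 3 * (n : ℝ) ^ 2 * 2 ^ n := by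
  have hmem : j ∈ range (n + 1) := mem_range.2 (Nat.lt_succ_of_le hj)
  have hle : (n.choose j : ℝ) * ((n : ℝ) - 2 * j) ^ 4 ≤
      ∑ i ∈ range (n + 1), (n.choose i : ℝ) * ((n : ℝ) - 2 * i) ^ 4 :=
    single_le_sum (f := fun i => (n.choose i : ℝ) * ((n : ℝ) - 2 * i) ^ 4)
      (fun i _ => by positivity) hmem
  rw [(binomMoments n).2] at hle
  have hn : (0 : ℝ) ≤ n := Nat.cast_nonneg n
  have h2 : (0 : ℝ) < 2 ^ n := by positivity
  calc ((n : ℝ) - 2 * j) ^ 4 * (n.choose j : ℝ)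
      = (n.choose j : ℝ) * ((n : ℝ) - 2 * j) ^ 4 := by ring
    _ ≤ (n : ℝ) * (3 * (n : ℝ) - 2) * 2 ^ n := hle
    _ ≤ 3 * (n : ℝ) ^ 2 * 2 ^ n := by nlinarith [mul_nonneg hn h2.le]

/-- Central binomial bound, squared and cleared of roots: `C(n,j)² (n+1) ≤ 4ⁿ`
(`C(n,j) ≤ C(n,⌊n/2⌋)` and `C(n,⌊n/2⌋)² (n+1) ≤ 4ⁿ`). -/
theorem choose_sq_mul_succ_le (n j : ℕ) : (n.choose j : ℝ) ^ 2 * ((n : ℝ) + 1) ≤ 4 ^ n := by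
  have h1 : n.choose j ≤ n.choose (n / 2) := Nat.choose_le_middle j n
  have h3 : (n.choose j) ^ 2 * (n + 1) ≤ 4 ^ n :=
    (Nat.mul_le_mul_right _ (Nat.pow_le_pow_left h1 2)).trans
      (Literature.Probability.LatticeModels.UniformStep.choose_half_sq_mul_succ_le n)
  exact_mod_cast h3

/-- **Stub B2** (`stub_ballotMaxBound`, registered signature): the largest two-row degree has a
power saving beyond `2ⁿ n^{-3/4}` — with `C = 6`, `δ = 1/8`,
`C(n,j) (n - 2j + 1)/(n - j + 1) ≤ 6 · 2ⁿ · n^{-7/8}` for all `n ≥ 1`, `2j ≤ n`. -/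
theorem stub_ballotMaxBound : ∃ C δ : ℝ, 0 < δ ∧ ∀ n : ℕ, 1 ≤ n → ∀ j : ℕ, 2 * j ≤ n → (n.choose j : ℝ) * ((n : ℝ) - 2 * j + 1) / ((n : ℝ) - j + 1) ≤ C * 2 ^ n * (n : ℝ) ^ (-(3 / 4 + δ)) := by
  refine ⟨6, 1 / 8, by norm_num, ?_⟩
  intro n hn j hj
  have hn1 : (1 : ℝ) ≤ n := by exact_mod_cast hn
  have hn0 : (0 : ℝ) < n := by linarith
  have hn0' : (n : ℝ) ≠ 0 := hn0.ne'
  have hjr : 2 * (j : ℝ) ≤ n := by exact_mod_cast hj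
  have hx0 : (0 : ℝ) ≤ (n : ℝ) - 2 * j := by linarith
  -- the three arithmetic inputs on `C(n,j)`
  have hA : ((n : ℝ) - 2 * j) ^ 4 * (n.choose j : ℝ) ≤ 3 * (n : ℝ) ^ 2 * 2 ^ n :=
    fourthMoment_term_le n j (by omega)
  have hB : (n.choose j : ℝ) ^ 2 * ((n : ℝ) + 1) ≤ 4 ^ n := choose_sq_mul_succ_le n j
  have h2n : (n.choose j : ℝ) ≤ 2 ^ n := by exact_mod_cast Nat.choose_le_two_pow n j
  have hc0 : (0 : ℝ) ≤ (n.choose j : ℝ) := Nat.cast_nonneg _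
  set c : ℝ := (n.choose j : ℝ) with hc_def
  have hB' : c ^ 2 ≤ 4 ^ n / n := by
    rw [le_div_iff₀ hn0]
    calc c ^ 2 * n ≤ c ^ 2 * ((n : ℝ) + 1) := by nlinarith [sq_nonneg c]
      _ ≤ 4 ^ n := hB
  -- the exponent `-(3/4 + 1/8) = 1/8 - 1`
  have hpow : (n : ℝ) ^ (-(3 / 4 + 1 / 8) : ℝ) = (n : ℝ) ^ (1 / 8 : ℝ) * (n : ℝ)⁻¹ := by
    rw [show (-(3 / 4 + 1 / 8) : ℝ) = 1 / 8 + -1 by norm_num, Real.rpow_add hn0,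
      Real.rpow_neg_one]
  rw [hpow]
  -- the eighth root of `n`
  set r : ℝ := (n : ℝ) ^ (1 / 8 : ℝ) with hr_def
  have hr0 : 0 ≤ r := Real.rpow_nonneg hn0.le _
  have hr1 : 1 ≤ r := Real.one_le_rpow hn1 (by norm_num)
  have hr8 : r ^ 8 = n := by
    rw [hr_def, ← Real.rpow_mul_natCast hn0.le]
    norm_num
  have h4 : (4 : ℝ) ^ n = (2 ^ n) ^ 2 := by
    rw [← pow_mul, mul_comm, pow_mul]
    norm_num
  -- term 1: `(n - 2j) C(n,j) ≤ 2 · 2ⁿ · n^{1/8}`, by comparing eighth powers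
  have hT1 : ((n : ℝ) - 2 * j) * c ≤ 2 * 2 ^ n * r := by
    refine le_of_pow_le_pow_left₀ (by norm_num : (8 : ℕ) ≠ 0)
      (mul_nonneg (by positivity) hr0) ?_
    have hkey : (0 : ℝ) ≤ n * (2 ^ n) ^ 8 := by positivity
    calc (((n : ℝ) - 2 * j) * c) ^ 8
        = (((n : ℝ) - 2 * j) ^ 4 * c) ^ 2 * (c ^ 2) ^ 3 := by ring
      _ ≤ (3 * (n : ℝ) ^ 2 * 2 ^ n) ^ 2 * (4 ^ n / n) ^ 3 :=
          mul_le_mul (pow_le_pow_left₀ (mul_nonneg (pow_nonneg hx0 4) hc0) hA 2)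
            (pow_le_pow_left₀ (sq_nonneg c) hB' 3) (by positivity) (by positivity)
      _ = 9 * ((n : ℝ) * (2 ^ n) ^ 8) := by
          rw [h4]
          field_simp
          ring
      _ ≤ 256 * ((n : ℝ) * (2 ^ n) ^ 8) := by linarith
      _ = (2 * 2 ^ n * r) ^ 8 := by
          rw [mul_pow, mul_pow, hr8]
          ring
  -- term 2: `C(n,j) ≤ 2ⁿ ≤ 2ⁿ · n^{1/8}`
  have hT2 : c ≤ 2 ^ n * r := by
    calc c ≤ 2 ^ n * 1 := by rw [mul_one]; exact h2n
      _ ≤ 2 ^ n * r := by gcongr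
  -- denominators: `n - j + 1 ≥ n/2`
  have hden : (0 : ℝ) < (n : ℝ) - j + 1 := by linarith
  have hfrac : (1 : ℝ) / 2 ≤ ((n : ℝ) - j + 1) / n := by
    rw [le_div_iff₀ hn0]
    linarith
  rw [div_le_iff₀ hden]
  calc c * ((n : ℝ) - 2 * j + 1) = ((n : ℝ) - 2 * j) * c + c := by ring
    _ ≤ 2 * 2 ^ n * r + 2 ^ n * r := add_le_add hT1 hT2
    _ = 6 * 2 ^ n * r * (1 / 2) := by ring
    _ ≤ 6 * 2 ^ n * r * (((n : ℝ) - j + 1) / n) :=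
        mul_le_mul_of_nonneg_left hfrac (mul_nonneg (by positivity) hr0)
    _ = 6 * 2 ^ n * (r * (n : ℝ)⁻¹) * ((n : ℝ) - j + 1) := by ring

end Summit.MatrixMultiplication.MatrixMultiplication.Theorems.GradedDesignFamily

end
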